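import Summits.CriticalPhenomena.PercolationContinuityZ3.Theorems.FK.Transplant.KNFreeLawTranslate
import Summits.CriticalPhenomena.PercolationContinuityZ3.Theorems.FK.Transplant.KNFreeLawSupport
import Summits.CriticalPhenomena.PercolationContinuityZ3.Theorems.FK.Transplant.KNFreeLawInterfaces
import HarnessLib

/-!
# FK-continuity transplant, FT-05a (launch part): FK-hittable geometries are launchable — the free look is the worst
# environment among all weightings that dominate it on the hitting box

Cell `fk-continuity` (bschramm), FRONTIER TRANSPLANT sub-cell, registry row FT-05a ("hittable ⇒ launchable under
dominating weights", writer fkt-p3 per coordinator R19; consumed inside row 2 = fkt-p1's FK target property and by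
the referee's consumption audit A8); support file (`--supports stmt-CriticalPhenomena-4575`); builds on p205010
(kernel theorem, internal audit signed; external expert review pending). HONEST FRAMING: the transplant
`ufsc0_of_freeBoundaryHypothesis_r0` this file serves is CONDITIONAL on the free-boundary penetration hypothesis FH
(open at the same `p` for `q > 1`; ⇔ GRC Conj. (5.103) via the referee's calibration K1; barrier note
`Literature.Barriers.CriticalPhenomena.SamePFreeBoundaryCriteria`, theorem `samePFreeBoundaryCriteria`, p243859); it
is a typed reduction, not a proof of FK continuity. THIS file is unconditional finite-volume measure theory: no named
facts, no sorries, standard axioms; nothing here is specific to `q = 2` or to `d = 3`.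

## What is here

`FKLaunchAt d q p g δ m ℓ` (FT-01, p243857) asks the bound `1 - δ < P(v + Λ_m ↔ v + ℓF in v + ℓQ)` under the law
`fkLaw Sfin W q` of EVERY finitely supported weighting `W` on `Sfin ⊇ v + ℓQ` that dominates the free-look weighting
`hitW p g ℓ m v` on the pairs inside the hitting box (revealed-open edges anywhere and an arbitrary pinned
environment outside the box allowed). For `q ≥ 1` this follows from the ONE free look at the base point `0`
(`FKLookAt`, i.e. one instance of `IsHittableFK`) by three unconditional steps, all landed in FT-05a:
translation to `v` (`fkLaw_hitW_real_linkIn_eq`, `KNFreeLawTranslate.lean`), Λ-independence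
(`fkLaw_eq_of_subset`: the free look lives on `v + ℓQ`, the environment on `Sfin`) and monotonicity in the
weighting (`fkLaw_real_mono_weights'`, Grimmett 2006 (3.22)) — since `hitW` VANISHES off the box, domination on
the box is domination everywhere, so no domain-Markov step is needed:

* `hitW_le_of_le_on_pairsF` — domination on `pairsF (v + ℓQ)` is pointwise domination (the link event is increasing:
  fkt-p2's `isUpperSet_linkIn_site`, `KNFreeLawInterfaces.lean`, imported);
* `fkLaunchAt_of_look` — one free look at thresholds `(δ; m, ℓ)` gives `FKLaunchAt d q p g δ m ℓ` (`1 ≤ q`);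
* `isLaunchableFK_of_isHittableFK` — `IsHittableFK q p g → IsLaunchableFK q p g` (`1 ≤ q`), for EVERY geometry `g`;
* `fh_isLaunchableFK` — under `FH d q p` every quarter-face geometry of `qfList d` is launchable (the content of the
  v1 binder `KNFreeLaunchBound`, now row-2-internal: `knFreeLaunchBound`).

## References

* G. Kozma, S. Nitzan, arXiv:2401.12397 (2024), §4 p. 16 (hittable geometry; targets `v + ℓQ ⊆ D`), (16) p. 17,
  (22) p. 20. [KozmaNitzan2024]
* G. Grimmett, *The Random-Cluster Model*, Springer 2006: Thm. (3.21), eq. (3.22); Lemma (4.13), (4.14)(b); §4.3.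
  [Grimmett2006]
-/

noncomputable section

open MeasureTheory Finset SimpleGraph
open scoped ENNReal Classical

namespace Summit.CriticalPhenomena.PercolationContinuityZ3.Theorems.FK

open Literature.Probability.Percolation Literature.Probability.LatticeModels
open Literature.Probability.Percolation.KozmaNitzan

variable {d : ℕ}

/-- The free-look weighting vanishes off the pairs inside the hitting box. [cite: KozmaNitzan2024, §4 p. 16] -/
theorem hitW_eq_zero_of_not_mem_pairsF (p : unitInterval) (g : Geom d) (ℓ m : ℕ) (v : Site d) {e : Sym2 (Site d)}
    (he : e ∉ pairsF (g.Qset ℓ v)) : hitW p g ℓ m v e = 0 := by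
  unfold hitW
  refine restrW_apply_of_not_mem _ fun h => he ?_
  rw [← Finset.mem_coe, coe_pairsF]
  exact h

/-- **Domination on the box is domination everywhere**: a weighting that dominates the free-look weighting on the
pairs inside `v + ℓQ` dominates it pointwise. [cite: KozmaNitzan2024, §4 p. 16; Grimmett2006, eq. (3.22)] -/
theorem hitW_le_of_le_on_pairsF (p : unitInterval) (g : Geom d) (ℓ m : ℕ) (v : Site d)
    {W : Sym2 (Site d) → unitInterval} (hdom : ∀ e ∈ pairsF (g.Qset ℓ v), hitW p g ℓ m v e ≤ W e) :
    hitW p g ℓ m v ≤ W := by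
  intro e
  by_cases he : e ∈ pairsF (g.Qset ℓ v)
  · exact hdom e he
  · rw [hitW_eq_zero_of_not_mem_pairsF p g ℓ m v he]
    exact unitInterval.nonneg'

/-- **One free look launches everywhere** (`1 ≤ q`): if the free look of `g` at thresholds `(δ; m, ℓ)` holds at the base
point `0` — `1 - δ < fkLaw (ℓQ) (hitW p g ℓ m 0) q (Λ_m ↔ ℓF in ℓQ)` — then `FKLaunchAt d q p g δ m ℓ`: under the
`fkLaw` of EVERY finitely supported weighting on `Sfin ⊇ v + ℓQ` dominating the free-look weighting on the box, the
seed `v + Λ_m` is joined to `v + ℓF` inside `v + ℓQ` with probability `> 1 - δ`. Translation + Λ-independence +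
monotonicity in the weighting; no conditioning. [cite: KozmaNitzan2024, §4 p. 16, (16) p. 17; Grimmett2006, eq. (3.22), §4.3] -/
theorem fkLaunchAt_of_look {q : ℝ} (hq : 1 ≤ q) {p : unitInterval} {g : Geom d} {δ : ℝ} {m ℓ : ℕ}
    (hlook : 1 - δ < (fkLaw (g.Qset ℓ 0) (hitW p g ℓ m 0) q).real
      (linkIn (↑(g.Qset ℓ 0)) (GM.ball 0 m) (g.Fset ℓ 0))) :
    FKLaunchAt d q p g δ m ℓ := by
  have hq0 : 0 < q := one_pos.trans_le hq
  intro W Sfin v hW hQ hdom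
  have hE : MeasurableSet (linkIn (↑(g.Qset ℓ v) : Set (Site d)) (GM.ball v m) (g.Fset ℓ v)) :=
    measurableSet_linkIn _ _ _
  calc 1 - δ < (fkLaw (g.Qset ℓ 0) (hitW p g ℓ m 0) q).real (linkIn (↑(g.Qset ℓ 0)) (GM.ball 0 m) (g.Fset ℓ 0)) :=
        hlook
    _ = (fkLaw (g.Qset ℓ v) (hitW p g ℓ m v) q).real (linkIn (↑(g.Qset ℓ v)) (GM.ball v m) (g.Fset ℓ v)) :=
        (fkLaw_hitW_real_linkIn_eq p g ℓ m v hq0).symm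
    _ = (fkLaw Sfin (hitW p g ℓ m v) q).real (linkIn (↑(g.Qset ℓ v)) (GM.ball v m) (g.Fset ℓ v)) := by
        have hfs : FinSupp (hitW p g ℓ m v) (g.Qset ℓ v) := by unfold hitW; exact finSupp_restrW _ _
        rw [fkLaw_eq_of_subset hQ hfs hq0]
    _ ≤ (fkLaw Sfin W q).real (linkIn (↑(g.Qset ℓ v)) (GM.ball v m) (g.Fset ℓ v)) :=
        fkLaw_real_mono_weights' Sfin (hitW_le_of_le_on_pairsF p g ℓ m v hdom) hq (isUpperSet_linkIn_site _ _ _) hE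

/-- **FK-hittable ⇒ FK-launchable** (`1 ≤ q`), for every geometry `g`: the thresholds are those of `IsHittableFK`.
This is the derivation "domain Markov = conditioning is pinning, comparison of boundary conditions = monotonicity in
the weights" named in FT-01's docstring of `FKLaunchAt` (the referee's consumption-audit point A8), in its sharp
form: only translation, Λ-independence and (3.22) are used. [cite: KozmaNitzan2024, §4 p. 16; Grimmett2006, eq. (3.22), Lemma (4.14)(b)] -/
theorem isLaunchableFK_of_isHittableFK {q : ℝ} (hq : 1 ≤ q) {p : unitInterval} {g : Geom d}
    (hg : IsHittableFK q p g) : IsLaunchableFK q p g := by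
  intro δ hδ
  obtain ⟨k, ℓ₀, h⟩ := hg.hit δ hδ
  exact ⟨k, ℓ₀, fun m hm ℓ hℓ => fkLaunchAt_of_look hq (h m hm ℓ hℓ)⟩

/-- **Under `FH` every quarter-face geometry is launchable** (`1 ≤ q`) — the content of the v1 binder
`KNFreeLaunchBound` (superseded as a binder of record before use, coordinator R16/R20; kept as a lemma).
[cite: KozmaNitzan2024, §4 Lemma 9 (p. 16); Grimmett2006, eq. (3.22)] -/
theorem fh_isLaunchableFK {q : ℝ} (hq : 1 ≤ q) {p : unitInterval} (hFH : FH d q p) :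
    ∀ g ∈ qfList d, IsLaunchableFK q p g :=
  fun g hg => isLaunchableFK_of_isHittableFK hq (hFH g hg)

/-- The v1 binder `KNFreeLaunchBound d q p` holds for `1 ≤ q` (it is not a binder of record; landed for the record's
history and the q-uniform consumption audit). [cite: KozmaNitzan2024, §4 Lemma 9 (p. 16); Grimmett2006, eq. (3.22)] -/
theorem knFreeLaunchBound {q : ℝ} (hq : 1 ≤ q) (p : unitInterval) : KNFreeLaunchBound d q p :=
  fun hFH => fh_isLaunchableFK hq hFH

end Summit.CriticalPhenomena.PercolationContinuityZ3.Theorems.FK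

end
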